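import Literature.NumberTheory.EllipticCurves.Kato2004.UniversalNormsIntegralProofs
import Literature.NumberTheory.EllipticCurves.SubgroupSelmer
import HarnessLib

/-!
# Kato 2004 (Astérisque 295) Lemma 8.5 (2) with general coefficients, tools: the inert step, the
# layers, `⋂ₘ pᵐ H¹(I, T) = 0` for compact `T`, and `H¹(U ⊓ I_𝔓, B)` finite for a finite discrete `B`

Topic `NumberTheory/EllipticCurves`, sub-directory `Kato2004` (namespace = path, sub-namespace
`UniversalNorms`).  THEOREMS ONLY (no definition, no named fact, no instance, no `sorry`).  Written by a
prover seat of the cell `bsd-wall` (route `ResidualThetaTransportAtTwo`, crux RSL_g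
stmt-BirchSwinnertonDyer-22608, stub-plan rev 12 item UN_ρ / card `stub-cmlambdalower-k3-g9` PLAN 1):
the COEFFICIENT port of the K6 package `UniversalNorms{Tools,Layers,InertiaFinite,IntegralProofs}`
(cell `bsd-smallim`), whose theorem `UniversalNorms.mem_integralH1_of_layerCores_eq` is Kato's
Lemma 8.5 (2) for `T = T_pW` ("the image of `lim←ₙ H¹(K(ζ_{pⁿ}), T) → H¹(K, T)` is contained in the
image of `H¹(O_K[1/p], T) → H¹(K, T)`" [Kato, p. 183] = [Rubin, *Euler Systems*, B.3.3]).  The printed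
lemma holds for EVERY finitely generated `ℤ_p`-module `T` with continuous `Gal(ℚ̄/ℚ)`-action; the
named fact `Kato2004.mem_integralH1_of_forall_layerCores_eq` carries the corresponding
`TODO(general form)`.  This file isolates the four steps of the K6 proof that do not depend on `W`,
for a continuous representation `T : GaloisRep ℚ A M` with arbitrary coefficient ring `A`:

* §1 `exists_resLe_coresLe_eq_pow_smul_of_generator_coeff` — the INERT STEP modulo `pᵐ` (verbatim
  the K6 statement with `ℤ_p ↦ A`): `res_{U ∩ I_𝔓}(cor_{V→U} ξ) ∈ pᵐ·H¹(U ∩ I_𝔓, T)` when `U/V` is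
  cyclic of order `pᵏ` generated by an element of the decomposition group, `I_𝔓 ≤ V`, and
  `H¹(U ∩ I_𝔓, T)` has a set `S` of residues modulo `pᵐ` with `#S·pᵐ ≤ pᵏ`
  (NSW (1.5.6)–(1.5.7) + the periodicity lemma `sum_range_pow_eq_zero_of_periodic_of_pow_smul`).
* §2 `eq_coresLe_add_succ_coeff` — `zₙ = cor_{Γ_{n+d+1} → Γₙ} z_{n+d+1}` for a cores-compatible family.
* §3 `eq_zero_of_forall_exists_pow_smul_eq_of_compactSpace` — **`⋂ₘ pᵐ H¹(I, T) = 0`** when the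
  coefficient module `M` is COMPACT Hausdorff and `pᵐ yₘ → 0` for every sequence `(yₘ)` (true for a
  finitely generated module over the integers of a finite extension of `ℚ_p`): the K6 cluster-point
  argument (Kato §8.2 `H^q(R, T) = lim←ₙ H^q(R, T/pⁿ)`; Rubin B.2.3).
* §4 `finite_subgroupH1_inf_inertia_of_finite` — **`H¹(U ⊓ I_𝔓, B)` is finite** for a FINITE discrete
  `Gal(ℚ̄/ℚ)`-module `B` of `p`-power order, `𝔓 ∣ v ≠ p`, `I_𝔓 ≤ U`: the local theorem
  `natCard_continuousCohomology_one_absInertia_le` (`#H¹(I_{ℚ_v}, B) ≤ #B`, Milne ADT I Lemma 2.9)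
  pulled back along `θ = ρ₀·res(·)·ρ₀⁻¹ : Γ_{ℚ_v} → Γ_ℚ`, which maps `I_{ℚ_v}` ONTO `I_𝔓`
  (`inertia_adicCompletionPrime_eq_map_absInertia`), exactly as in the K6 file for `B = W[p]`.

No new mathematics: each proof is the K6 proof with `tateRep W p ↦ T`, `ℤ_[p] ↦ A`, `W[p] ↦ B`.
HONEST FRAMING: nothing here is specific to BSD or to the crux; BSD is not proved by any of this.

References: K. Kato, Astérisque 295 (2004), §8.2, Lemma 8.5 (pp. 180–184) [Kato2004Asterisque];
K. Rubin, *Euler Systems* (2000), App. B Prop. B.2.3, B.3.3 [Rubin2000]; J. Neukirch, A. Schmidt,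
K. Wingberg, *Cohomology of Number Fields* (2008), I §5 (1.5.6)–(1.5.7) [NeukirchSchmidtWingberg2008];
J. S. Milne, *Arithmetic Duality Theorems* (2006), I §2 Lemma 2.9 [MilneADT2006]; J. Neukirch,
*Algebraic Number Theory* (1999), Ch. II §9 (9.6) [NeukirchANT1999].
-/

noncomputable section

open scoped NumberField Pointwise Valued
open CategoryTheory Field IsDedekindDomain Filter Topology
open Literature.NumberTheory.GaloisRepresentations
open Literature.NumberTheory.EllipticCurves
open Literature.NumberTheory.EllipticCurves.ZpExtension
open Literature.NumberTheory.EllipticCurves.Kato2004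
open Literature.NumberTheory.EllipticCurves.Kato2004.EulerSystemValues
open Rat.HeightOneSpectrum

namespace Literature.NumberTheory.EllipticCurves.Kato2004.UniversalNorms

/-! ## §1 The inert step modulo `p^m`, coefficients `A` -/

section Inert

variable {A : Type} [CommRing A] [TopologicalSpace A] {M : Type} [AddCommGroup M] [Module A M]
  [TopologicalSpace M] [IsTopologicalAddGroup M] [ContinuousSMul A M]
  (T : GaloisRep ℚ A M) (p : ℕ) [Fact p.Prime]

/-- Two successive restrictions are the restriction along the composite inclusion (coefficient form
of the K6 private lemma `resLe_resLe'`). [cite: SerreGaloisCohomology1997, I §2.4] -/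
theorem resLe_resLe_coeff {H H' H'' : Subgroup (absoluteGaloisGroup ℚ)} (h : H ≤ H') (h' : H' ≤ H'')
    (c : H1 T H'') :
    resLe T.toTopRep h 1 (resLe T.toTopRep h' 1 c) = resLe T.toTopRep (h.trans h') 1 c := by
  obtain ⟨ψ, rfl⟩ := oneCocycleClass_surjective _ c
  rw [resLe_oneCocycleClass, resLe_oneCocycleClass, resLe_oneCocycleClass]
  exact congrArg _ (Subtype.ext (ContinuousMap.ext fun _ => rfl))

/-- **Inert step modulo `p^m`, coefficients `A`.**  `V ⊴ Γ_ℚ` open in `U ≥ V` with `U/V` of order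
`p ^ k` generated by the class of an element `φ ∈ U` of the decomposition group of `𝔓` (`φ • 𝔓 = 𝔓`),
`I_𝔓 ≤ V`, and a finite set `S` of residues of `N = H¹(U ∩ I_𝔓, T)` modulo `p^m N` with
`#S · p^m ≤ p^k`.  Then for every `ξ ∈ H¹(V, T)`, `res_{U ∩ I_𝔓} (cor_{V→U} ξ) ∈ p^m N`: by the normal
case of the double coset formula with representatives `φ^i` (`resLe_coresLe_eq_sum_conjMap`),
`res (cor ξ) = Σ_{i<p^k} res (φ^i · ξ)`, a `p^k`-periodic sequence which is shift-deterministic modulo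
`p^m N` (`exists_resLe_conjMap_eq_smul`), so the periodicity lemma applies in the finite module
`N/p^m N`.  Verbatim the K6 theorem `exists_resLe_coresLe_eq_pow_smul_of_generator` with `ℤ_p ↦ A`.
[cite: NeukirchSchmidtWingberg2008, I §5 (1.5.6)–(1.5.7)] [cite: Kato2004Asterisque, Lemma 8.5 (2) (pp. 183–184)] -/
theorem exists_resLe_coresLe_eq_pow_smul_of_generator_coeff
    {V U : Subgroup (absoluteGaloisGroup ℚ)} [V.Normal] (h : V ≤ U)
    (hV : IsOpen (V : Set (absoluteGaloisGroup ℚ))) [Fintype (U ⧸ V.subgroupOf U)]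
    {k : ℕ} (hPk : Fintype.card (U ⧸ V.subgroupOf U) = p ^ k)
    {𝔓 : Ideal (absIntegers (𝓞 ℚ) ℚ)} (hIV : 𝔓.inertia (absoluteGaloisGroup ℚ) ≤ V)
    {φ : absoluteGaloisGroup ℚ} (hφU : φ ∈ U) (hφ𝔓 : φ • 𝔓 = 𝔓)
    (hgen : ∀ u ∈ U, ∃ i : ℕ, (φ ^ i)⁻¹ * u ∈ V) {m : ℕ}
    (S : Finset (H1 T (U ⊓ 𝔓.inertia (absoluteGaloisGroup ℚ))))
    (hS : ∀ x, ∃ s ∈ S, ∃ y : H1 T (U ⊓ 𝔓.inertia (absoluteGaloisGroup ℚ)),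
      x - s = ((p : A) ^ m) • y)
    (hcard : S.card * p ^ m ≤ p ^ k) (ξ : H1 T V) :
    ∃ y : H1 T (U ⊓ 𝔓.inertia (absoluteGaloisGroup ℚ)),
      resLe T.toTopRep (inf_le_left : U ⊓ 𝔓.inertia (absoluteGaloisGroup ℚ) ≤ U) 1
        (coresLe T.toTopRep h hV ξ) = ((p : A) ^ m) • y := by
  classical
  set X := T.toTopRep with hX
  set P := Fintype.card (U ⧸ V.subgroupOf U) with hP
  have hp : p.Prime := Fact.out
  -- `φ ^ P ∈ V`
  have hφP : φ ^ P ∈ V := by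
    have h1 : (((⟨φ, hφU⟩ : U) : U ⧸ V.subgroupOf U)) ^ P = 1 := pow_card_eq_one
    rw [← QuotientGroup.mk_pow, QuotientGroup.eq_one_iff, Subgroup.mem_subgroupOf,
      SubgroupClass.coe_pow] at h1
    exact h1
  -- the bijection `Fin P ≃ U/V`, `i ↦ [φ^i]`
  let f : Fin P → U ⧸ V.subgroupOf U := fun i => (((⟨φ, hφU⟩ : U) ^ (i : ℕ) : U) : U ⧸ V.subgroupOf U)
  have hfsurj : Function.Surjective f := by
    intro x
    induction x using QuotientGroup.induction_on with
    | H u =>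
      obtain ⟨i, hi⟩ := hgen u u.2
      have hPpos : 0 < P := Fintype.card_pos
      refine ⟨⟨i % P, Nat.mod_lt _ hPpos⟩, ?_⟩
      change (((⟨φ, hφU⟩ : U) ^ (i % P) : U) : U ⧸ V.subgroupOf U) = (u : U ⧸ V.subgroupOf U)
      rw [QuotientGroup.eq, Subgroup.mem_subgroupOf]
      push_cast
      have hdecomp : (φ ^ (i % P))⁻¹ * (u : absoluteGaloisGroup ℚ) =
          (φ ^ P) ^ (i / P) * ((φ ^ i)⁻¹ * (u : absoluteGaloisGroup ℚ)) := by
        have hpow : φ ^ i = φ ^ (i % P) * (φ ^ P) ^ (i / P) := by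
          rw [← pow_mul, ← pow_add, Nat.mod_add_div]
        rw [hpow, mul_inv_rev, ← mul_assoc, ← mul_assoc, mul_inv_cancel, one_mul]
      rw [hdecomp]
      exact V.mul_mem (V.pow_mem hφP _) hi
  have hfbij : Function.Bijective f :=
    (Fintype.bijective_iff_surjective_and_card f).mpr ⟨hfsurj, by simp [hP]⟩
  let e : Fin P ≃ U ⧸ V.subgroupOf U := Equiv.ofBijective f hfbij
  let s : U ⧸ V.subgroupOf U → U := fun x => (⟨φ, hφU⟩ : U) ^ ((e.symm x : Fin P) : ℕ)
  have hs : ∀ x, (s x : U ⧸ V.subgroupOf U) = x := fun x => by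
    change f (e.symm x) = x
    exact e.apply_symm_apply x
  -- `res_V (cor ξ) = Σ_{i<P} φ^i · ξ`
  have hsum : resLe X h 1 (coresLe X h hV ξ) = ∑ i ∈ Finset.range P, conjMap X V (φ ^ i) 1 ξ := by
    rw [resLe_coresLe_eq_sum_conjMap X h hV hs ξ]
    have hsx : ∀ x, ((s x : U) : absoluteGaloisGroup ℚ) = φ ^ ((e.symm x : Fin P) : ℕ) := fun x => by
      simp only [s, SubgroupClass.coe_pow]
    simp_rw [hsx]
    rw [e.symm.sum_comp (fun i : Fin P => conjMap X V (φ ^ (i : ℕ)) 1 ξ),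
      Fin.sum_univ_eq_sum_range (fun i => conjMap X V (φ ^ i) 1 ξ) P]
  -- the sequence `a i = res_{U ∩ I_𝔓} (φ^i · ξ)` and the submodule `N = p^m M`
  have hIU : U ⊓ 𝔓.inertia (absoluteGaloisGroup ℚ) ≤ V := fun g hg => hIV hg.2
  have hconjI : ∀ g ∈ U ⊓ 𝔓.inertia (absoluteGaloisGroup ℚ),
      φ⁻¹ * g * φ ∈ U ⊓ 𝔓.inertia (absoluteGaloisGroup ℚ) := by
    intro g hg
    refine ⟨U.mul_mem (U.mul_mem (U.inv_mem hφU) hg.1) hφU, ?_⟩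
    refine (Ideal.conj_mem_inertia_smul_iff 𝔓 φ (φ⁻¹ * g * φ)).mp ?_
    rw [hφ𝔓, show φ * (φ⁻¹ * g * φ) * φ⁻¹ = g by group]
    exact hg.2
  let a : ℕ → H1 T (U ⊓ 𝔓.inertia (absoluteGaloisGroup ℚ)) := fun i =>
    resLe X hIU 1 (conjMap X V (φ ^ i) 1 ξ)
  let N : Submodule A (H1 T (U ⊓ 𝔓.inertia (absoluteGaloisGroup ℚ))) :=
    LinearMap.range (((p : A) ^ m) • LinearMap.id)
  have hN : ∀ x : H1 T (U ⊓ 𝔓.inertia (absoluteGaloisGroup ℚ)),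
      x ∈ N ↔ ∃ y, x = ((p : A) ^ m) • y := by
    intro x
    simp only [N, LinearMap.mem_range, LinearMap.smul_apply, LinearMap.id_apply]
    exact ⟨fun ⟨y, hy⟩ => ⟨y, hy.symm⟩, fun ⟨y, hy⟩ => ⟨y, hy.symm⟩⟩
  have htrans : resLe X (inf_le_left : U ⊓ 𝔓.inertia (absoluteGaloisGroup ℚ) ≤ U) 1
      (coresLe X h hV ξ) = resLe X hIU 1 (resLe X h 1 (coresLe X h hV ξ)) :=
    (resLe_resLe_coeff T hIU h _).symm
  -- reduce to `Σ a i ∈ N`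
  suffices hmem : ∑ i ∈ Finset.range P, a i ∈ N by
    obtain ⟨y, hy⟩ := (hN _).mp hmem
    refine ⟨y, ?_⟩
    rw [htrans, hsum, map_sum]
    exact hy
  -- work in `M / N`
  let π := N.mkQ
  have hπa : ∀ i j, π (a i) = π (a j) → π (a (i + 1)) = π (a (j + 1)) := by
    intro i j hij
    rw [Submodule.mkQ_apply, Submodule.mkQ_apply, Submodule.Quotient.eq] at hij ⊢
    obtain ⟨c, hc⟩ := (hN _).mp hij
    have hy : resLe X hIU 1 (conjMap X V (φ ^ i) 1 ξ - conjMap X V (φ ^ j) 1 ξ) =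
        ((p : A) ^ m) • c := by
      rw [map_sub]; exact hc
    obtain ⟨c', hc'⟩ := exists_resLe_conjMap_eq_smul X V φ hIU hIU hconjI ((p : A) ^ m) hy
    refine (hN _).mpr ⟨c', ?_⟩
    rw [← hc']
    change resLe X hIU 1 (conjMap X V (φ ^ (i + 1)) 1 ξ) - resLe X hIU 1 (conjMap X V (φ ^ (j + 1)) 1 ξ) = _
    rw [pow_succ', pow_succ', ← conjMap_conjMap X V (φ ^ i) φ 1 ξ, ← conjMap_conjMap X V (φ ^ j) φ 1 ξ,
      ← map_sub, ← map_sub]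
  have hper : ∀ i, a (i + p ^ k) = a i := by
    intro i
    change resLe X hIU 1 (conjMap X V (φ ^ (i + p ^ k)) 1 ξ) = resLe X hIU 1 (conjMap X V (φ ^ i) 1 ξ)
    rw [pow_add, ← conjMap_conjMap X V (φ ^ p ^ k) (φ ^ i) 1 ξ, ← hPk,
      conjMap_eq_self_of_mem_one X V hφP ξ]
  -- the periodicity lemma in `M / N`
  have haS : ∀ i, π (a i) ∈ S.image π := by
    intro i
    obtain ⟨s, hs, y, hy⟩ := hS (a i)
    rw [Finset.mem_image]
    refine ⟨s, hs, ?_⟩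
    rw [Submodule.mkQ_apply, Submodule.mkQ_apply, Submodule.Quotient.eq]
    exact (hN _).mpr ⟨-y, by rw [smul_neg, ← hy]; abel⟩
  have hcard' : (S.image π).card * p ^ m ≤ p ^ k :=
    le_trans (Nat.mul_le_mul_right _ Finset.card_image_le) hcard
  have htor : ∀ i, p ^ m • π (a i) = 0 := by
    intro i
    rw [← Nat.cast_smul_eq_nsmul A, Nat.cast_pow, ← map_smul, Submodule.mkQ_apply,
      Submodule.Quotient.mk_eq_zero]
    exact (hN _).mpr ⟨a i, rfl⟩
  have hzero := sum_range_pow_eq_zero_of_periodic_of_pow_smul hp (fun i => π (a i)) haS hcard'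
    (fun i => by simp only [hper]) hπa htor
  rw [hPk, ← Submodule.Quotient.mk_eq_zero N, ← Submodule.mkQ_apply, map_sum]
  exact hzero

end Inert

/-! ## §2 Iterated cores compatibility along the layers, coefficients `A` -/

section Layers

variable {A : Type} [CommRing A] [TopologicalSpace A] {M : Type} [AddCommGroup M] [Module A M]
  [TopologicalSpace M] [IsTopologicalAddGroup M] [ContinuousSMul A M]
  (T : GaloisRep ℚ A M) {p : ℕ} [Fact p.Prime]

/-- **Iterated cores compatibility**: `z_n = cor_{Γ_{n+d+1} → Γ_n} z_{n+d+1}` for a cores-compatible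
family along the layers of a `ℤ_p`-extension (`layerCores`, transitivity of corestriction
`coresLe_comp`); verbatim the K6 `eq_coresLe_add_succ` with `tateRep W p ↦ T`.
[cite: Kato2004Asterisque, §12.2 (p. 220)] [cite: NeukirchSchmidtWingberg2008, Prop. 1.5.3] -/
theorem eq_coresLe_add_succ_coeff (κ : ZpExtension ℚ p) (z : ∀ n : ℕ, H1 T (κ.layerSubgroup n))
    (hz : ∀ n, layerCores T κ n (z (n + 1)) = z n) (n : ℕ) :
    ∀ (d : ℕ) [Fintype (κ.layerSubgroup n ⧸ (κ.layerSubgroup (n + d + 1)).subgroupOf (κ.layerSubgroup n))],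
      z n = coresLe T.toTopRep
        (κ.layerSubgroup_antitone (Nat.le_add_right n (d + 1)) :
          κ.layerSubgroup (n + d + 1) ≤ κ.layerSubgroup n)
        (κ.isOpen_layerSubgroup (n + d + 1)) (z (n + d + 1))
  | 0, inst => by
      haveI := finiteIndex_layerSubgroup p κ (n + 0 + 1)
      have e : inst = Fintype.ofFinite _ := Subsingleton.elim _ _
      subst e
      rw [← hz n]
      unfold layerCores
      congr 1
  | d + 1, inst => by
      haveI := finiteIndex_layerSubgroup p κ (n + d + 1)
      haveI := finiteIndex_layerSubgroup p κ (n + d + 1 + 1)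
      letI i1 : Fintype (κ.layerSubgroup n ⧸ (κ.layerSubgroup (n + d + 1)).subgroupOf (κ.layerSubgroup n)) :=
        Fintype.ofFinite _
      letI i2 : Fintype (κ.layerSubgroup (n + d + 1) ⧸
          (κ.layerSubgroup (n + d + 1 + 1)).subgroupOf (κ.layerSubgroup (n + d + 1))) :=
        Fintype.ofFinite _
      have ih := eq_coresLe_add_succ_coeff κ z hz n d
      have hstep : z (n + d + 1) = coresLe T.toTopRep
          (κ.layerSubgroup_antitone (Nat.le_succ (n + d + 1)))
          (κ.isOpen_layerSubgroup (n + d + 1 + 1)) (z (n + d + 1 + 1)) := by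
        rw [← hz (n + d + 1)]
        unfold layerCores
        congr 1
      rw [ih, hstep, ← LinearMap.comp_apply,
        coresLe_comp T.toTopRep (κ.layerSubgroup_antitone (Nat.le_succ (n + d + 1)))
          (κ.layerSubgroup_antitone (Nat.le_add_right n (d + 1))) (κ.isOpen_layerSubgroup (n + d + 1 + 1))
          (κ.isOpen_layerSubgroup (n + d + 1))]
      rfl

end Layers

/-! ## §3 `⋂_m p^m H¹(I, T) = 0` for a compact Hausdorff coefficient module -/

section Separated

variable {A : Type} [CommRing A] [TopologicalSpace A] {M : Type} [AddCommGroup M] [Module A M]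
  [TopologicalSpace M] [IsTopologicalAddGroup M] [ContinuousSMul A M]
  (T : GaloisRep ℚ A M) (p : ℕ)

/-- **`⋂_m p^m H¹(I, T) = 0`** for every subgroup `I ≤ Γ_ℚ`, when the coefficient module `M` of `T` is
COMPACT Hausdorff and `p^m • y_m → 0` for every sequence `(y_m)` in `M` (e.g. `M` a finitely generated
module over the valuation ring of a finite extension of `ℚ_p`): a class divisible by every power of `p`
vanishes.  PROOF (the K6 argument for `T_pW`, verbatim): write `c = [φ]` and `φ = p^m φ_m + ∂t_m` for all
`m`; `(t_m)` has a cluster point `t`; for fixed `g`, `g t_m − t_m = φ(g) − p^m φ_m(g) → φ(g)` and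
`s ↦ g s − s` is continuous, so `φ(g) = g t − t` (`M` Hausdorff).  (Kato §8.2: `H^q(R, T) = lim←_n
H^q(R, T/p^n)`; Rubin B.2.3.) [cite: Kato2004Asterisque, §8.2 (p. 180)] [cite: Rubin2000, App. B Prop. B.2.3] -/
theorem eq_zero_of_forall_exists_pow_smul_eq_of_compactSpace [CompactSpace M] [T2Space M]
    (h0 : ∀ y : ℕ → M, Tendsto (fun m => ((p : A) ^ m) • y m) atTop (𝓝 0))
    (I : Subgroup (absoluteGaloisGroup ℚ)) (c : H1 T I)
    (hc : ∀ m : ℕ, ∃ c' : H1 T I, ((p : A) ^ m) • c' = c) : c = 0 := by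
  classical
  obtain ⟨φ, rfl⟩ := oneCocycleClass_surjective (subgroupRep T.toTopRep I) c
  -- `φ - p^m φ_m = ∂ t_m`
  have hm : ∀ m : ℕ, ∃ (φm : contOneCocycles (subgroupRep T.toTopRep I)) (t : M),
      ∀ g, φ.1 g - ((p : A) ^ m) • φm.1 g = (subgroupRep T.toTopRep I).ρ g t - t := by
    intro m
    obtain ⟨c', hc'⟩ := hc m
    obtain ⟨φm, rfl⟩ := oneCocycleClass_surjective _ c'
    have h1 : oneCocycleClass (subgroupRep T.toTopRep I) (φ - ((p : A) ^ m) • φm) = 0 := by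
      rw [oneCocycleClass_sub, oneCocycleClass_smul, hc', sub_self]
    obtain ⟨t, ht⟩ := (oneCocycleClass_eq_zero_iff _ _).mp h1
    refine ⟨φm, t, fun g => ?_⟩
    have := ht g
    rwa [Submodule.coe_sub, ContinuousMap.sub_apply, Submodule.coe_smul, ContinuousMap.smul_apply] at this
  choose φm t ht using hm
  obtain ⟨t₀, -, ht₀⟩ := isCompact_univ.exists_mapClusterPt (f := atTop) (u := t)
    (le_principal_iff.mpr univ_mem)
  rw [oneCocycleClass_eq_zero_iff]
  refine ⟨t₀, fun g => ?_⟩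
  have hF : Continuous fun s : M => (subgroupRep T.toTopRep I).ρ g s - s :=
    ((subgroupRep T.toTopRep I).ρ g).continuous.sub continuous_id
  have h1 : MapClusterPt ((subgroupRep T.toTopRep I).ρ g t₀ - t₀) atTop
      ((fun s : M => (subgroupRep T.toTopRep I).ρ g s - s) ∘ t) :=
    ht₀.continuousAt_comp hF.continuousAt
  have h3 := h0 (fun m => (φm m).1 g)
  have h5 : Tendsto (fun m => φ.1 g - ((p : A) ^ m) • (φm m).1 g) atTop (𝓝 (φ.1 g - 0)) :=
    (tendsto_const_nhds (x := φ.1 g) (f := (atTop : Filter ℕ))).sub h3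
  rw [sub_zero] at h5
  have e : ((fun s : M => (subgroupRep T.toTopRep I).ρ g s - s) ∘ t) =
      fun m => φ.1 g - ((p : A) ^ m) • (φm m).1 g := by
    funext m
    exact (ht m g).symm
  rw [e] at h1
  have h4 : ClusterPt ((subgroupRep T.toTopRep I).ρ g t₀ - t₀) (𝓝 (φ.1 g)) := h1.clusterPt.mono h5
  exact (eq_of_nhds_neBot h4.neBot).symm

end Separated

/-! ## §4 `H¹(U ⊓ I_𝔓, B)` is finite for a finite discrete `Gal(ℚ̄/ℚ)`-module `B` of order prime to `v` -/

section FiniteCoeff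

variable {B : Type} [AddCommGroup B] [DistribMulAction (absoluteGaloisGroup ℚ) B]
  [TopologicalSpace B] [DiscreteTopology B] [Finite B]

/-- **`H¹(U ⊓ I_𝔓, B)` is finite** for a finite discrete `Gal(ℚ̄/ℚ)`-module `B` (continuous action
`ρB`, `ρB σ b = σ • b`) of `p`-power order, every rational prime `v ≠ p`, every prime `𝔓` of `ℤ̄` over
`v` and every `U ≤ Γ_ℚ` containing `I_𝔓` (so `U ⊓ I_𝔓` has the elements of `I_𝔓`).  PROOF (the K6 proof
of `finite_H1_torsionGaloisModule_inertia` for `B = W[p]`, verbatim): the homomorphism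
`θ = ρ₀ res(·) ρ₀⁻¹ : Γ_{ℚ_v} → Γ_ℚ` (`ρ₀ 𝔓₀ = 𝔓`, `𝔓₀` the prime cut out by `ℚ̄ → ℚ̄_v`) maps the local
inertia group `I_{ℚ_v}` ONTO `I_𝔓` (`inertia_adicCompletionPrime_eq_map_absInertia`), so pulling back
classes along `θ` embeds `H¹(U ⊓ I_𝔓, B)` into `H¹(I_{ℚ_v}, B|θ)`, which is finite of order `≤ #B`
(`natCard_continuousCohomology_one_absInertia_le`, Milne ADT I Lemma 2.9 / Serre CG II §5.5).
[cite: MilneADT2006, I §2 Lemma 2.9] [cite: NeukirchANT1999, Ch. II §9 Prop. (9.6)] -/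
theorem finite_subgroupH1_inf_inertia_of_finite (ρB : DiscreteGaloisModule ℚ B)
    (hρB : ∀ (σ : absoluteGaloisGroup ℚ) (b : B), ρB σ b = σ • b) (p : ℕ) [Fact p.Prime] {r : ℕ}
    (hB : Nat.card B = p ^ r) {v : HeightOneSpectrum (𝓞 ℚ)} (hv : (p : 𝓞 ℚ) ∉ v.asIdeal)
    {𝔓 : Ideal (absIntegers (𝓞 ℚ) ℚ)} (h𝔓 : 𝔓 ∈ v.primesAbove)
    {U : Subgroup (absoluteGaloisGroup ℚ)} (hIU : 𝔓.inertia (absoluteGaloisGroup ℚ) ≤ U) :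
    Finite (subgroupH1 (U ⊓ 𝔓.inertia (absoluteGaloisGroup ℚ)) B) := by
  classical
  -- `𝔓 = ρ₀ • 𝔓₀`
  have h𝔓₀ : adicCompletionPrime ℚ v ∈ v.primesAbove := adicCompletionPrime_mem_primesAbove ℚ v
  obtain ⟨ρ₀, hρ₀⟩ := HeightOneSpectrum.exists_smul_eq_of_mem_primesAbove_holds h𝔓₀ h𝔓
  -- `θ : Γ_{ℚ_v} → Γ_ℚ`, `x ↦ ρ₀ res(x) ρ₀⁻¹`
  let res₀ := absGaloisRestrict ℚ (v.adicCompletion ℚ)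
  let θ : absoluteGaloisGroup (v.adicCompletion ℚ) →ₜ* absoluteGaloisGroup ℚ :=
    { toFun := fun x => ρ₀ * res₀ x * ρ₀⁻¹
      map_one' := by simp
      map_mul' := fun a b => by rw [map_mul]; group
      continuous_toFun := (continuous_const.mul res₀.continuous).mul continuous_const }
  have hθ : ∀ x, θ x = ρ₀ * res₀ x * ρ₀⁻¹ := fun _ => rfl
  -- `θ (I_{ℚ_v}) = I_𝔓 ⊆ U ⊓ I_𝔓`
  have hθI : ∀ x ∈ absInertia (v.adicCompletion ℚ),
      θ x ∈ U ⊓ 𝔓.inertia (absoluteGaloisGroup ℚ) := by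
    intro x hx
    have h1 : res₀ x ∈ (adicCompletionPrime ℚ v).inertia (absoluteGaloisGroup ℚ) := by
      rw [inertia_adicCompletionPrime_eq_map_absInertia]
      exact ⟨x, hx, rfl⟩
    have h2 : θ x ∈ 𝔓.inertia (absoluteGaloisGroup ℚ) := by
      rw [hθ, ← hρ₀]
      exact (Ideal.conj_mem_inertia_smul_iff _ ρ₀ (res₀ x)).mpr h1
    exact ⟨hIU h2, h2⟩
  have hθsurj : ∀ γ ∈ U ⊓ 𝔓.inertia (absoluteGaloisGroup ℚ),
      ∃ x ∈ absInertia (v.adicCompletion ℚ), θ x = γ := by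
    intro γ hγ
    have hγ' : γ ∈ (ρ₀ • adicCompletionPrime ℚ v).inertia (absoluteGaloisGroup ℚ) := by
      rw [hρ₀]; exact hγ.2
    have h2 : ρ₀⁻¹ * γ * ρ₀ ∈ (adicCompletionPrime ℚ v).inertia (absoluteGaloisGroup ℚ) :=
      (HeightOneSpectrum.mem_inertia_smul_absIntegers_iff ρ₀ _ _).mp hγ'
    rw [inertia_adicCompletionPrime_eq_map_absInertia] at h2
    obtain ⟨x, hx, hxe⟩ := Subgroup.mem_map.mp h2
    refine ⟨x, hx, ?_⟩
    rw [hθ, show res₀ x = ρ₀⁻¹ * γ * ρ₀ from hxe]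
    group
  -- the restriction of `θ` to the inertia groups
  let θI : absInertia (v.adicCompletion ℚ) →ₜ* (U ⊓ 𝔓.inertia (absoluteGaloisGroup ℚ) : Subgroup _) :=
    { toFun := fun x => ⟨θ x, hθI x x.2⟩
      map_one' := Subtype.ext (by simp)
      map_mul' := fun a b => Subtype.ext (by simp)
      continuous_toFun := Continuous.subtype_mk (θ.continuous.comp continuous_subtype_val) _ }
  -- the local representation `B|θ` and the finiteness of `H¹(I_{ℚ_v}, B|θ)`
  let ρl : ContinuousRep (absoluteGaloisGroup (v.adicCompletion ℚ)) ℤ B := ρB.restrict θ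
  have hq := not_ringChar_residueField_adicCompletion_dvd_of_not_mem (K := ℚ) (ℓ := p) hv
  have hqprime := ringChar_residueField_prime (F := v.adicCompletion ℚ)
  obtain ⟨hfin, -⟩ := natCard_continuousCohomology_one_absInertia_le (v.adicCompletion ℚ) ρl (by
    rw [hB]
    exact Nat.Coprime.pow_left r (Nat.coprime_comm.mp ((Nat.Prime.coprime_iff_not_dvd hqprime).mpr hq)))
  -- the pull-back `H¹(U ⊓ I_𝔓, B) → H¹(I_{ℚ_v}, B|θ)` is injective
  let fI : TopRep.res (θI : absInertia (v.adicCompletion ℚ) →* (U ⊓ 𝔓.inertia (absoluteGaloisGroup ℚ) : Subgroup _))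
      (discreteTopRep (U ⊓ 𝔓.inertia (absoluteGaloisGroup ℚ) : Subgroup _) B) ⟶
      (ρl.restrict (subgroupIncl (absInertia (v.adicCompletion ℚ)))).toTopRep :=
    TopRep.ofHom
      { toLinearMap := (AddMonoidHom.id B).toIntLinearMap
        cont := continuous_of_discreteTopology (α := B)
        isIntertwining' := fun x => by
          ext b
          change (((θI x : (U ⊓ 𝔓.inertia (absoluteGaloisGroup ℚ) : Subgroup _)) :
              absoluteGaloisGroup ℚ)) • b = ρB (θ (x : absoluteGaloisGroup (v.adicCompletion ℚ))) b
          rw [hρB]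
          rfl }
  let pull := ContinuousCohomology.map θI fI 1
  have key : ∀ c, pull c = 0 → c = 0 := by
    intro c hc
    obtain ⟨φ, rfl⟩ := oneCocycleClass_surjective _ c
    change ContinuousCohomology.map θI fI 1 (oneCocycleClass _ φ) = 0 at hc
    rw [map_oneCocycleClass, oneCocycleClass_eq_zero_iff] at hc
    obtain ⟨b, hb⟩ := hc
    rw [oneCocycleClass_eq_zero_iff]
    refine ⟨b, fun γ => ?_⟩
    obtain ⟨x, hx, hxγ⟩ := hθsurj γ γ.2
    have e : θI ⟨x, hx⟩ = γ := Subtype.ext hxγ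
    have hbx := hb ⟨x, hx⟩
    rw [contOneCocycles.pullback_apply, TopRep.hom_ofHom, e] at hbx
    change φ.1 γ = ρB (θ x) b - b at hbx
    change φ.1 γ = ((γ : absoluteGaloisGroup ℚ)) • b - b
    rw [hbx, hρB, hxγ]
  have hinj : Function.Injective pull := by
    intro a b hab
    have h0 : pull (a - b) = 0 := by rw [map_sub, hab, sub_self]
    exact sub_eq_zero.mp (key _ h0)
  exact @Finite.of_injective _ _ hfin pull hinj

end FiniteCoeff

end Literature.NumberTheory.EllipticCurves.Kato2004.UniversalNorms

end
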